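import Literature.NumberTheory.EllipticCurves.TateCurve.FormalEulerProductDefs
import Literature.NumberTheory.EllipticCurves.TateCurve.PowerSeriesEval
import Literature.NumberTheory.EllipticCurves.TateCurve.UniformizationTheta
import Mathlib.Analysis.SpecialFunctions.Exp
import HarnessLib

/-!
# The formal Euler product `∏_{n≥1} (1 − m qⁿ) ∈ R⟦q⟧`: stabilisation and evaluation
# `P(v) = ∏ (1 − qⁿv)` (Silverman, *Advanced Topics*, Prop. V.3.2; proofs only)

Topic `Literature/NumberTheory/EllipticCurves/TateCurve`, namespace
`Literature.NumberTheory.EllipticCurves.TateCurve` (cell `bsd-eis`, seat `bsd-eis-k5-c4` g3; input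
T1 of the discharge of `SteinWuthrich2013.exists_isSplitMultCanonical`, via Silverman's theta
relation Prop. V.3.2 (b)(i) and the `q`-expansion transfer machine of `LaurentSeriesEval` /
`PowerSeriesEval` / `LaurentSeriesIdentity2`).

Silverman proves the identities of Prop. V.3.2 (b) "formally in `ℚ(u₁,u₂)⟦q⟧`" from the complex
case. To run the theta function `θ(u,q) = (1−u)∏(1−qⁿu)(1−qⁿu⁻¹)/(1−qⁿ)²` (Prop. V.3.2 (a); tree
`tateTheta q u = (1−u) P(u) P(u⁻¹)/P(1)²`, `P(v) = tateP q v = ∏'_{n} (1 − q^{n+1} v)`) through that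
machine one needs its building block `P` as a FORMAL `q`-series with coefficients in the
coefficient ring `R` (`R = ℤ[u₁^{±1},u₂^{±1}]`, `m` a monomial), together with an evaluation lemma.
For the definitions `eulerFin m N = ∏_{n<N} (1 − m q^{n+1})`, `eulerForm m` (formal infinite
product) of `FormalEulerProductDefs.lean` this file (theorems only) proves:

* the coefficients of the finite products stabilise (`coeff_eulerFin_of_le`, `coeff_eulerForm`);
* along a ring hom `f : R → 𝕜` into a complete normed field and `‖q‖ < 1`:
  `PowerSeriesEval.conv_eulerForm` (absolute convergence, by the majorant
  `∏ (1 + ‖f m‖ ‖q‖^{n+1}) ≤ exp(‖f m‖ ‖q‖/(1 − ‖q‖))`) and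
  **`PowerSeriesEval.ev_eulerForm : ev f q (eulerForm m) = tateP q (f m)`**.

All statements hold verbatim for `𝕜 = ℂ` and for `p`-adic `𝕜`.

## References
* [SilvermanATAEC1994] J. H. Silverman, *Advanced Topics in the Arithmetic of Elliptic Curves*,
  GTM 151, Springer 1994, Prop. V.3.2 and its proof (PDF pp. 399–400); proof of Thm. V.3.1 (c)
  (PDF p. 397) for the transfer principle.
-/

noncomputable section

open PowerSeries Finset Filter Topology

namespace Literature.NumberTheory.EllipticCurves.TateCurve

section Formal

variable {R : Type*} [CommRing R]

/-- `eulerFin m 0 = 1`. [cite: SilvermanATAEC1994, Prop. V.3.2 (a) (PDF p. 399)] -/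
theorem eulerFin_zero (m : R) : eulerFin m 0 = 1 := by
  simp [eulerFin]

/-- `eulerFin m (N+1) = eulerFin m N · (1 − m q^{N+1})`. [cite: SilvermanATAEC1994, Prop. V.3.2 (a) (PDF p. 399)] -/
theorem eulerFin_succ (m : R) (N : ℕ) :
    eulerFin m (N + 1) = eulerFin m N * (1 - PowerSeries.C m * X ^ (N + 1)) :=
  prod_range_succ _ _

/-- Coefficients of `Φ · (1 − m qᵏ)`. [folklore] [cite: SilvermanATAEC1994, Prop. V.3.2 (a) (proof, PDF p. 399)] -/
theorem coeff_mul_one_sub_C_mul_X_pow (Φ : PowerSeries R) (m : R) (k d : ℕ) :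
    coeff d (Φ * (1 - PowerSeries.C m * X ^ k)) =
      coeff d Φ - if k ≤ d then m * coeff (d - k) Φ else 0 := by
  rw [mul_sub, mul_one, map_sub, ← mul_assoc, mul_comm Φ (PowerSeries.C m), mul_assoc,
    coeff_C_mul, coeff_mul_X_pow']
  split_ifs <;> simp

/-- **Stabilisation**: for `d ≤ N` the `d`-th coefficient of `∏_{n<N}(1 − m q^{n+1})` is that of
`∏_{n<d}`. [cite: SilvermanATAEC1994, Prop. V.3.2 (a) (PDF p. 399)] -/
theorem coeff_eulerFin_of_le (m : R) {d N : ℕ} (h : d ≤ N) :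
    coeff d (eulerFin m N) = coeff d (eulerFin m d) := by
  induction N, h using Nat.le_induction with
  | base => rfl
  | succ N hdN ih =>
    rw [eulerFin_succ, coeff_mul_one_sub_C_mul_X_pow, if_neg (by omega), sub_zero, ih]

/-- `coeff d (eulerForm m) = coeff d (eulerFin m N)` for every `N ≥ d`.
[cite: SilvermanATAEC1994, Prop. V.3.2 (a) (PDF p. 399)] -/
theorem coeff_eulerForm (m : R) {d N : ℕ} (h : d ≤ N) :
    coeff d (eulerForm m) = coeff d (eulerFin m N) := by
  rw [eulerForm, coeff_mk, coeff_eulerFin_of_le m h]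

/-- The real majorant has nonnegative coefficients, nondecreasing in `N`: for `0 ≤ a`,
`0 ≤ coeff d (eulerFin (−a) N) ≤ coeff d (eulerFin (−a) (N+1))`. [folklore] [cite: SilvermanATAEC1994, Prop. V.3.2 (a) (proof, PDF p. 399)] -/
theorem coeff_eulerFin_nonneg {a : ℝ} (ha : 0 ≤ a) (N d : ℕ) :
    0 ≤ coeff d (eulerFin (-a) N) := by
  induction N generalizing d with
  | zero =>
    rw [eulerFin_zero, coeff_one]
    split_ifs <;> norm_num
  | succ N ih =>
    rw [eulerFin_succ, coeff_mul_one_sub_C_mul_X_pow]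
    split_ifs
    · have := ih d; have := ih (d - (N + 1)); nlinarith
    · rw [sub_zero]; exact ih d

/-- Monotonicity of the majorant coefficients in `N`. [folklore] [cite: SilvermanATAEC1994, Prop. V.3.2 (a) (proof, PDF p. 399)] -/
theorem coeff_eulerFin_mono {a : ℝ} (ha : 0 ≤ a) (d : ℕ) {N N' : ℕ} (h : N ≤ N') :
    coeff d (eulerFin (-a) N) ≤ coeff d (eulerFin (-a) N') := by
  induction N', h using Nat.le_induction with
  | base => exact le_rfl
  | succ N' _ ih =>
    refine ih.trans ?_
    rw [eulerFin_succ, coeff_mul_one_sub_C_mul_X_pow]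
    split_ifs
    · have := coeff_eulerFin_nonneg ha N' (d - (N' + 1)); nlinarith
    · rw [sub_zero]

end Formal

/-! ### Evaluation -/

namespace PowerSeriesEval

variable {R : Type*} [CommRing R] {𝕜 : Type*} [NormedField 𝕜] (f : R →+* 𝕜) (q : 𝕜)

/-- Terms of `qᵏ`. [folklore] [cite: SilvermanATAEC1994, Prop. V.3.2 (a) (proof, PDF p. 399)] -/
theorem term_X_pow (k d : ℕ) : term f q ((X : PowerSeries R) ^ k) d = if d = k then q ^ k else 0 := by
  rw [term, coeff_X_pow]
  split_ifs with h
  · rw [map_one, one_mul, h]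
  · rw [map_zero, zero_mul]

/-- `qᵏ` converges. [folklore] [cite: SilvermanATAEC1994, Prop. V.3.2 (a) (proof, PDF p. 399)] -/
theorem conv_X_pow (k : ℕ) : Conv f q ((X : PowerSeries R) ^ k) := by
  refine summable_of_ne_finset_zero (s := {k}) fun d hd => ?_
  rw [Finset.mem_singleton] at hd
  rw [term_X_pow, if_neg hd, norm_zero]

/-- `ev (qᵏ) = qᵏ`. [folklore] [cite: SilvermanATAEC1994, Prop. V.3.2 (a) (proof, PDF p. 399)] -/
theorem ev_X_pow (k : ℕ) : ev f q ((X : PowerSeries R) ^ k) = q ^ k := by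
  rw [ev, tsum_eq_single k fun d hd => by rw [term_X_pow, if_neg hd], term_X_pow, if_pos rfl]

/-- The Euler factor `1 − m qᵏ` converges. [cite: SilvermanATAEC1994, Prop. V.3.2 (a) (PDF p. 399)] -/
theorem conv_eulerFactor (m : R) (k : ℕ) : Conv f q (1 - PowerSeries.C m * X ^ k) := by
  rw [← map_one PowerSeries.C]
  exact (Conv.C f q 1).sub f q ((conv_X_pow f q k).C_mul f q m)

/-- `ev (1 − m qᵏ) = 1 − qᵏ f(m)`. [cite: SilvermanATAEC1994, Prop. V.3.2 (a) (PDF p. 399)] -/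
theorem ev_eulerFactor [CompleteSpace 𝕜] (m : R) (k : ℕ) :
    ev f q (1 - PowerSeries.C m * X ^ k) = 1 - q ^ k * f m := by
  rw [← map_one PowerSeries.C, ev_sub f q (Conv.C f q 1) ((conv_X_pow f q k).C_mul f q m), ev_C,
    map_one, ev_C_mul, ev_X_pow, mul_comm]

/-- The finite Euler product converges. [cite: SilvermanATAEC1994, Prop. V.3.2 (a) (PDF p. 399)] -/
theorem conv_eulerFin [CompleteSpace 𝕜] (m : R) : ∀ N : ℕ, Conv f q (eulerFin m N)
  | 0 => by rw [eulerFin_zero, ← map_one PowerSeries.C]; exact Conv.C f q 1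
  | N + 1 => by rw [eulerFin_succ]; exact (conv_eulerFin m N).mul f q (conv_eulerFactor f q m _)

/-- `ev (∏_{n<N}(1 − m q^{n+1})) = ∏_{n<N} (1 − q^{n+1} f(m))`.
[cite: SilvermanATAEC1994, Prop. V.3.2 (a) (PDF p. 399)] -/
theorem ev_eulerFin [CompleteSpace 𝕜] (m : R) :
    ∀ N : ℕ, ev f q (eulerFin m N) = ∏ n ∈ range N, (1 - q ^ (n + 1) * f m)
  | 0 => by rw [eulerFin_zero, prod_range_zero, ← map_one PowerSeries.C, ev_C, map_one]
  | N + 1 => by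
    rw [eulerFin_succ, ev_mul f q (conv_eulerFin f q m N) (conv_eulerFactor f q m _), ev_eulerFin m N,
      ev_eulerFactor, prod_range_succ]

/-- **The majorant**: `‖f(coeff_d ∏_{n<N}(1 − m q^{n+1}))‖ ≤ coeff_d ∏_{n<N}(1 + ‖f m‖ q^{n+1})`.
[folklore] [cite: SilvermanATAEC1994, Prop. V.3.2 (a) (proof, PDF p. 399)] -/
theorem norm_coeff_eulerFin_le (m : R) (N d : ℕ) :
    ‖f (coeff d (eulerFin m N))‖ ≤ coeff d (eulerFin (-‖f m‖) N) := by
  induction N generalizing d with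
  | zero =>
    rw [eulerFin_zero, eulerFin_zero, coeff_one, coeff_one]
    split_ifs
    · rw [map_one, norm_one]
    · rw [map_zero, norm_zero]
  | succ N ih =>
    rw [eulerFin_succ, eulerFin_succ, coeff_mul_one_sub_C_mul_X_pow, coeff_mul_one_sub_C_mul_X_pow]
    split_ifs
    · rw [map_sub, map_mul]
      refine (norm_sub_le _ _).trans ?_
      rw [norm_mul]
      have h1 := ih d
      have h2 := ih (d - (N + 1))
      have h3 : ‖f m‖ * ‖f (coeff (d - (N + 1)) (eulerFin m N))‖ ≤
          ‖f m‖ * coeff (d - (N + 1)) (eulerFin (-‖f m‖) N) :=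
        mul_le_mul_of_nonneg_left h2 (norm_nonneg _)
      linarith
    · rw [sub_zero, sub_zero]; exact ih d

/-- The value of the real majorant: `Σ_d coeff_d(∏_{n<N}(1 + a r^{n+1})) r^d ≤ exp(a r/(1−r))` for
`0 ≤ a`, `0 ≤ r < 1`, as a bound on every partial sum. [folklore] [cite: SilvermanATAEC1994, Prop. V.3.2 (a) (proof, PDF p. 399)] -/
theorem sum_coeff_eulerFin_majorant_le {a r : ℝ} (ha : 0 ≤ a) (hr0 : 0 ≤ r) (hr : r < 1)
    (N : ℕ) (s : Finset ℕ) :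
    ∑ d ∈ s, coeff d (eulerFin (-a) N) * r ^ d ≤ Real.exp (a * (r / (1 - r))) := by
  -- the partial sum is bounded by the full (finite-support) sum `= ∏ (1 + a r^{n+1})`
  have hconv := conv_eulerFin (RingHom.id ℝ) r (-a) N
  have hev := ev_eulerFin (RingHom.id ℝ) r (-a) N
  have hterm : ∀ d, term (RingHom.id ℝ) r (eulerFin (-a) N) d = coeff d (eulerFin (-a) N) * r ^ d :=
    fun d => rfl
  have hnn : ∀ d, 0 ≤ term (RingHom.id ℝ) r (eulerFin (-a) N) d := fun d => by
    rw [hterm]; exact mul_nonneg (coeff_eulerFin_nonneg ha N d) (pow_nonneg hr0 d)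
  have hsum : Summable (term (RingHom.id ℝ) r (eulerFin (-a) N)) := Summable.of_norm hconv
  calc ∑ d ∈ s, coeff d (eulerFin (-a) N) * r ^ d
      = ∑ d ∈ s, term (RingHom.id ℝ) r (eulerFin (-a) N) d := sum_congr rfl fun d _ => (hterm d).symm
    _ ≤ ∑' d, term (RingHom.id ℝ) r (eulerFin (-a) N) d :=
        hsum.sum_le_tsum s fun d _ => hnn d
    _ = ∏ n ∈ range N, (1 - r ^ (n + 1) * (RingHom.id ℝ) (-a)) := hev
    _ = ∏ n ∈ range N, (1 + a * r ^ (n + 1)) := prod_congr rfl fun n _ => by simp; ring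
    _ ≤ ∏ n ∈ range N, Real.exp (a * r ^ (n + 1)) := by
        refine prod_le_prod (fun n _ => by positivity) fun n _ => ?_
        have := Real.add_one_le_exp (a * r ^ (n + 1)); linarith
    _ = Real.exp (∑ n ∈ range N, a * r ^ (n + 1)) := (Real.exp_sum _ _).symm
    _ ≤ Real.exp (a * (r / (1 - r))) := by
        refine Real.exp_le_exp.mpr ?_
        rw [← mul_sum]
        refine mul_le_mul_of_nonneg_left ?_ ha
        have hgeom : HasSum (fun n : ℕ => r ^ (n + 1)) (r / (1 - r)) := by
          have h := (hasSum_geometric_of_lt_one hr0 hr).mul_left r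
          rw [div_eq_mul_inv]
          refine h.congr_fun fun n => ?_
          rw [pow_succ']
        exact sum_le_hasSum (range N) (fun n _ => pow_nonneg hr0 _) hgeom

/-- **Absolute convergence of the formal Euler product** at `‖q‖ < 1`, with the summable majorant
`β_d = coeff_d(∏_{n<d+?}(1 + ‖f m‖ ‖q‖^{n+1})) ‖q‖^d` controlling both `eulerForm` and all the
finite products beyond their stable range. [cite: SilvermanATAEC1994, Prop. V.3.2 (a) (PDF p. 399)] -/
theorem summable_eulerMajorant (m : R) (hq : ‖q‖ < 1) :
    Summable fun d : ℕ => coeff d (eulerFin (-‖f m‖) d) * ‖q‖ ^ d := by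
  refine summable_of_sum_range_le
    (fun d => mul_nonneg (coeff_eulerFin_nonneg (norm_nonneg _) d d) (pow_nonneg (norm_nonneg _) d))
    (c := Real.exp (‖f m‖ * (‖q‖ / (1 - ‖q‖)))) fun D => ?_
  calc ∑ d ∈ range D, coeff d (eulerFin (-‖f m‖) d) * ‖q‖ ^ d
      = ∑ d ∈ range D, coeff d (eulerFin (-‖f m‖) D) * ‖q‖ ^ d := by
        refine sum_congr rfl fun d hd => ?_
        rw [coeff_eulerFin_of_le (-‖f m‖) (mem_range.mp hd).le]
    _ ≤ _ := sum_coeff_eulerFin_majorant_le (norm_nonneg _) (norm_nonneg _) hq D (range D)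

/-- `‖term (eulerForm m) d‖ ≤ β_d`. [cite: SilvermanATAEC1994, Prop. V.3.2 (a) (PDF p. 399)] -/
theorem norm_term_eulerForm_le (m : R) (d : ℕ) :
    ‖term f q (eulerForm m) d‖ ≤ coeff d (eulerFin (-‖f m‖) d) * ‖q‖ ^ d := by
  rw [term, coeff_eulerForm m le_rfl, norm_mul, norm_pow]
  exact mul_le_mul_of_nonneg_right (norm_coeff_eulerFin_le f m d d) (pow_nonneg (norm_nonneg _) d)

/-- `‖term (eulerFin m N) d‖ ≤ β_d` for `N ≤ d`. [cite: SilvermanATAEC1994, Prop. V.3.2 (a) (PDF p. 399)] -/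
theorem norm_term_eulerFin_le (m : R) {N d : ℕ} (h : N ≤ d) :
    ‖term f q (eulerFin m N) d‖ ≤ coeff d (eulerFin (-‖f m‖) d) * ‖q‖ ^ d := by
  rw [term, norm_mul, norm_pow]
  exact mul_le_mul_of_nonneg_right
    ((norm_coeff_eulerFin_le f m N d).trans (coeff_eulerFin_mono (norm_nonneg _) d h))
    (pow_nonneg (norm_nonneg _) d)

/-- **The formal Euler product converges absolutely** for `‖q‖ < 1`.
[cite: SilvermanATAEC1994, Prop. V.3.2 (a) (PDF p. 399)] -/
theorem conv_eulerForm (m : R) (hq : ‖q‖ < 1) : Conv f q (eulerForm m) :=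
  Summable.of_nonneg_of_le (fun _ => norm_nonneg _) (norm_term_eulerForm_le f q m)
    (summable_eulerMajorant f q m hq)

variable [CompleteSpace 𝕜]

/-- **Evaluation of the formal Euler product: `ev (∏_{n≥1}(1 − m qⁿ)) = ∏_{n≥1} (1 − qⁿ f(m)) = P(f m)`**
(`tateP`), in every complete normed field with `‖q‖ < 1` — over `ℂ` and `p`-adically alike. The finite
products evaluate to the partial products (which tend to `tateP`, `hasProd_tateP`), and differ from
`ev (eulerForm m)` only in degrees `> N`, where both are dominated by the tail of the summable
majorant. [cite: SilvermanATAEC1994, Prop. V.3.2 (a) (PDF p. 399)] -/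
theorem ev_eulerForm (m : R) (hq : ‖q‖ < 1) : ev f q (eulerForm m) = tateP q (f m) := by
  set β : ℕ → ℝ := fun d => coeff d (eulerFin (-‖f m‖) d) * ‖q‖ ^ d with hβ
  have hβs : Summable β := summable_eulerMajorant f q m hq
  have hβ0 : ∀ d, 0 ≤ β d := fun d =>
    mul_nonneg (coeff_eulerFin_nonneg (norm_nonneg _) d d) (pow_nonneg (norm_nonneg _) d)
  have hΦ : Conv f q (eulerForm m) := conv_eulerForm f q m hq
  -- the partial products
  have hlim : Tendsto (fun N => ∏ n ∈ range N, (1 - q ^ (n + 1) * f m)) atTop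
      (𝓝 (tateP q (f m))) := (hasProd_tateP hq (f m)).tendsto_prod_nat
  -- `‖ev Φ − ev F_N‖ ≤ 2 Σ_{d ≥ N+1} β_d`
  have hdiff : ∀ N, ‖ev f q (eulerForm m) - ∏ n ∈ range N, (1 - q ^ (n + 1) * f m)‖ ≤
      2 * ∑' d, β (d + (N + 1)) := by
    intro N
    have hF : Conv f q (eulerFin m N) := conv_eulerFin f q m N
    rw [← ev_eulerFin f q m N, ← ev_sub f q hΦ hF]
    have hδs : Summable fun d => ‖term f q (eulerForm m - eulerFin m N) d‖ := hΦ.sub f q hF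
    refine (norm_tsum_le_tsum_norm hδs).trans ?_
    -- compare termwise with `2 β_d` off `range (N+1)` and `0` on it
    have hle : ∀ d, ‖term f q (eulerForm m - eulerFin m N) d‖ ≤
        if d < N + 1 then 0 else 2 * β d := by
      intro d
      split_ifs with hd
      · rw [term, map_sub, coeff_eulerForm m (Nat.lt_succ_iff.mp hd), sub_self, map_zero, zero_mul,
          norm_zero]
      · rw [sub_eq_add_neg, term_add, term_neg]
        refine (norm_add_le _ _).trans ?_
        rw [norm_neg, two_mul]
        exact add_le_add (norm_term_eulerForm_le f q m d)
          (norm_term_eulerFin_le f q m (by omega))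
    have hgs : Summable fun d => if d < N + 1 then (0 : ℝ) else 2 * β d := by
      refine Summable.of_nonneg_of_le (fun d => ?_) (fun d => ?_) (hβs.mul_left 2)
      · split_ifs
        · exact le_rfl
        · exact mul_nonneg zero_le_two (hβ0 d)
      · split_ifs
        · exact mul_nonneg zero_le_two (hβ0 d)
        · exact le_rfl
    refine (Summable.tsum_le_tsum hle hδs hgs).trans (le_of_eq ?_)
    rw [← hgs.sum_add_tsum_nat_add (N + 1), sum_eq_zero fun d hd => by
      rw [if_pos (mem_range.mp hd)], zero_add, ← tsum_mul_left]
    refine tsum_congr fun d => ?_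
    rw [if_neg (by omega)]
  -- the tails tend to `0`, so the partial products tend to `ev Φ`
  have htail : Tendsto (fun N : ℕ => 2 * ∑' d, β (d + (N + 1))) atTop (𝓝 0) := by
    have h := (tendsto_sum_nat_add β).comp (tendsto_add_atTop_nat 1)
    have h2 := h.const_mul 2
    rw [mul_zero] at h2
    exact h2
  have hlim' : Tendsto (fun N => ∏ n ∈ range N, (1 - q ^ (n + 1) * f m)) atTop
      (𝓝 (ev f q (eulerForm m))) := by
    rw [tendsto_iff_norm_sub_tendsto_zero]
    refine squeeze_zero (fun N => norm_nonneg _) (fun N => ?_) htail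
    rw [norm_sub_rev]; exact hdiff N
  exact tendsto_nhds_unique hlim' hlim

end PowerSeriesEval

end Literature.NumberTheory.EllipticCurves.TateCurve

end
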